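import Summits.ResolutionOfSingularities.ResolutionOfSingularities.Theorems.FrobeniusClosingPatchingRelPerfectDepthWeightTwoBEnd
import Summits.ResolutionOfSingularities.ResolutionOfSingularities.Theorems.FrobeniusClosingPatchingRelPerfectDepthWeightTwoBNrState
import Summits.ResolutionOfSingularities.ResolutionOfSingularities.Theorems.FrobeniusClosingPatchingRelPerfectDepthWeightTwoBPieceStep
import Summits.ResolutionOfSingularities.ResolutionOfSingularities.Theorems.FrobeniusClosingPatchingRelPerfectDepthOneDivisorialFactorization
import Summits.ResolutionOfSingularities.ResolutionOfSingularities.Theorems.FrobeniusClosingPatchingRelPerfectDepthSNCPointwiseCongr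
import Summits.ResolutionOfSingularities.ResolutionOfSingularities.Theorems.FrobeniusClosingPatchingRelPerfectDepthMixedFormatBStepLemmas
import Literature.AlgebraicGeometry.Resolution.CartierDivisorReduced
import Literature.AlgebraicGeometry.Resolution.KollarNmPartBlowup
import Literature.AlgebraicGeometry.Resolution.RsopMonomialIdeals
import Literature.AlgebraicGeometry.Resolution.StalkIdealGenerization
import HarnessLib

/-!
# Crux `PatchingRelPerfect` (stmt-ResolutionOfSingularities-16161), chain W5.2 — F5c / TargetsF5c T5-E^nr
# `WeightTwoBoundaryJRnr₃`: N5 «END FACTORISATION» and the END PACKAGE without reducedness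

[OURS · L1 W5.2 · F5c] Fact-free; NOT statements of the manuscript under review.  In res-D-pv-054's E-side transport
of T5-E (`…DepthWeightTwoB*`) the host is carried REDUCED (`StateIn.hostRad`), consumed only by the off-centre transport of
the permissibility clause and by THE END (`StateIn.endClauses`).  For T5-E^nr (`…DepthMixedTargetsJRnr`; owner
res-D-pv-052, state `WeightTwoB.StateNr` = `StateIn` minus `hostRad`, `…DepthWeightTwoBNrState`) the host is any effective
Cartier divisor with the same support and the end becomes (res-D-pv-052's cut 2026-08-27T11:17:08Z N5 / 11:38:11Z):
* `Nr.exists_endFactor` — **N5 END FACTORISATION**: on a regular integral Noetherian scheme an effective Cartier `D` with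
  REGULAR reduced zero-scheme `V(𝓘(Supp D))` is `monomialIdeal 𝓟`, `𝓟 = [(𝓘(P_ζ), ord_ζ D)]_ζ` over the codimension-one
  points of `Supp D` (Cossart–Piltant: a locally principal ideal IS its divisorial part, tree
  `divisorialPart_eq_self_of_isLocallyPrincipal`), the members being irreducible, reduced, effective Cartier, REGULAR and
  pairwise DISJOINT (components of the regular `V(√D)`, tree `RegularCentreComponents`), locally equal to `√D`, covering
  `Supp D`, without repetition, with exponents `≥ 1`;
* `Nr.endPackage` / `StateNr.endPackage` — **THE END PACKAGE**: from the state without `hostRad` and the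
  Cossart–Jannsen–Saito end clauses through `e : E₁ ≅ Z₁` exactly as in `StateIn.endClauses`: the factorisation, whose
  components are not boundary sheaves and form WITH the boundary ONE snc family `HasSNC (boundaryOf 𝓟 ++ boundaryOf ℬ′)`
  (P3 on `Z₁` through `e`, read at each point on the unique component through it), the components of exponent `≥ 2`
  MISSING every N-charged member — a corollary of (J#) `joint` (there the host is a regular parameter) — and no boundary
  sheaf containing the host: the «MID» datum of res-L1-w52-stub-1's PEEL loop (`isWeightedSeqJR_peel`) towards `EndStateJR`;
* tools `Nr.not_stalkIdeal_le_sq_of_sncWithAt`, `Nr.not_stalkIdeal_boundary_le` (`StateIn.not_stalkIdeal_le_host` generalised).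

AI-written; AI review is weaker than expert review.

## References
* V. Cossart, O. Piltant, J. Algebra 320 (2008) 1051–1082, proof of Prop. 4.2 (divisorial part). [CossartPiltant2008]
* V. Cossart, U. Jannsen, S. Saito, LNM 2270 (2020), Thm. 1.4, Def. 4.1, p. 7. [CossartJannsenSaito2020]
* J. Kollár, *Lectures on Resolution of Singularities* (2007), (3.111) Step 3, 3.104 Step 2.1, 3.30.2. [Kollar2007]
* H. Matsumura, *Commutative Ring Theory* (1987), Thm. 14.2, Thm. 20.3. [Matsumura1987]
-/

-- `Summit.<Summit>.<Sub>.Theorems` with `Sub = Summit` (single-conjunct summit, D-0017)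
set_option linter.dupNamespace false

noncomputable section

open CategoryTheory CategoryTheory.Limits AlgebraicGeometry TopologicalSpace IsLocalRing
open Literature.AlgebraicGeometry.Resolution Scheme.IdealSheafData

namespace Summit.ResolutionOfSingularities.ResolutionOfSingularities.Theorems

universe u

namespace WeightTwoB

open DepthSNC

namespace Nr

/-! ## §1 Two pointwise tools -/

/-- **A member of an snc family has order one at each of its points**: if `SNCWithAt E C x`, `D ∈ E` and `x ∈ V(D)`, then
`D_x ⊄ 𝔪_x²` (its stalk is generated by a regular parameter). [cite: Matsumura1987, Thm. 14.2] -/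
theorem not_stalkIdeal_le_sq_of_sncWithAt {X : Scheme.{u}} {E : List X.IdealSheafData} {C : X.IdealSheafData} {x : X}
    (h : SNCWithAt E C x) {D : X.IdealSheafData} (hD : D ∈ E) (hx : x ∈ D.support) :
    ¬ stalkIdeal D x ≤ maximalIdeal (X.presheaf.stalk x) ^ 2 := by
  obtain ⟨hreg, d, v, hd, hv, ⟨ι, _, hιD⟩, -⟩ := h
  haveI := hreg
  have hrsop : IsRsopPart (v ∘ id) := isRsopPart_comp_of_rsop hd v hv id Function.injective_id
  intro hle
  refine hrsop.not_mem_sq (ι ⟨D, hD, hx⟩) (hle ?_)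
  rw [hιD ⟨D, hD, hx⟩]
  exact Ideal.mem_span_singleton_self _

/-- **No boundary sheaf has its stalk inside that of a Cartier divisor supported on the host** at a common point: it would
put the generic point of its irreducible support on the host, against «no boundary component» (res-D-pv-054's
`StateIn.not_stalkIdeal_le_host` with the host replaced by any effective Cartier `H`, `Supp H ⊆ Supp D`).
[cite: Kollar2007, 3.30.2] -/
theorem not_stalkIdeal_boundary_le {W : Scheme.{u}} [IsLocallyNoetherian W] (hW : Scheme.IsRegular W)
    {ℬ : List (W.IdealSheafData × ℕ)} (hsncB : HasSNC (boundaryOf ℬ))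
    (hirred : ∀ p ∈ ℬ, IsIrreducible (p.1.support : Set W)) {D : W.IdealSheafData}
    (hfree : ∀ p ∈ ℬ, ¬ ((p.1.support : Set W) ⊆ D.support)) {H : W.IdealSheafData} (hH : IsEffectiveCartier H)
    (hHD : (H.support : Set W) ⊆ D.support) {p : W.IdealSheafData × ℕ} (hp : p ∈ ℬ) {x : W}
    (hxB : x ∈ p.1.support) (hxH : x ∈ H.support) : ¬ stalkIdeal p.1 x ≤ stalkIdeal H x := by
  haveI := hW x
  haveI := isDomain_of_isRegularLocalRing (W.presheaf.stalk x)
  intro hle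
  obtain ⟨ξ, hξ⟩ := QuasiSober.sober (hirred p hp) p.1.support.isClosed
  have hξx : ξ ⤳ x := hξ.specializes hxB
  have hBmem : p.1 ∈ boundaryOf ℬ := List.mem_map.mpr ⟨p, hp, rfl⟩
  -- the stalk of the member at `x` is the prime of `ξ`
  have hBx : stalkIdeal p.1 x = primeOfSpecializes hξx := by
    have hcl : p.1.support = ⟨closure {ξ}, isClosed_closure⟩ := Closeds.ext hξ.symm
    rw [← hsncB.vanishingIdeal_support hBmem, hcl, stalkIdeal_vanishingIdeal_closure hξx]
  -- generators: `B_x = (u)` with `u` prime, `H_x = (g)` with `g ∈ 𝔪`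
  obtain ⟨u, hu0, hu⟩ := (hsncB.isEffectiveCartier_of_mem hBmem).exists_stalkIdeal_eq_span x
  obtain ⟨g, -, hg⟩ := hH.exists_stalkIdeal_eq_span x
  have hgm : g ∈ maximalIdeal (W.presheaf.stalk x) := by
    have h := (mem_support_iff_stalkIdeal_le H x).mp hxH
    rw [hg, Ideal.span_singleton_le_iff_mem] at h
    exact h
  haveI hprime : (primeOfSpecializes hξx).IsPrime := Ideal.IsPrime.comap _
  have huprime : Prime u := by
    rw [← Ideal.span_singleton_prime (nonZeroDivisors.ne_zero hu0), ← hu, hBx]; exact hprime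
  -- `(u) ≤ (g)`: `u = g c`; `u` prime and `g` a non-unit force `u ∣ g`, so `(g) ≤ (u)` and `ξ ∈ Supp H`
  rw [hu, hg, Ideal.span_singleton_le_span_singleton] at hle
  obtain ⟨c, hc⟩ := hle
  have hug : u ∣ g := by
    rcases huprime.dvd_or_dvd (show u ∣ g * c from ⟨1, by rw [mul_one, hc]⟩) with h | h
    · exact h
    · exfalso
      obtain ⟨d, hd⟩ := h
      have h1 : u * (1 - g * d) = 0 := by linear_combination hc + g * hd
      rcases mul_eq_zero.mp h1 with h0 | h0
      · exact nonZeroDivisors.ne_zero hu0 h0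
      · have hunit : IsUnit g := isUnit_iff_exists_inv.mpr ⟨d, by linear_combination -h0⟩
        exact (maximalIdeal.isMaximal _).ne_top (Ideal.eq_top_of_isUnit_mem _ hgm hunit)
  have hHξ : stalkIdeal H x ≤ primeOfSpecializes hξx := by
    rw [← hBx, hu, hg]; exact Ideal.span_singleton_le_span_singleton.mpr hug
  have hξH : ξ ∈ H.support := (mem_support_iff_stalkIdeal_le_primeOfSpecializes hξx H).mpr hHξ
  refine hfree p hp ?_
  rw [← hξ]
  exact (closure_minimal (Set.singleton_subset_iff.mpr hξH) H.support.isClosed).trans hHD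

/-! ## §2 N5 — the END FACTORISATION of a Cartier divisor with regular reduced zero-scheme -/

/-- [OURS · L1 W5.2 · F5c · N5] **END FACTORISATION.**  On a regular integral Noetherian scheme, an effective Cartier `D`
with regular reduced zero-scheme `V(𝓘(Supp D))` is `monomialIdeal 𝓟`, `𝓟 = [(𝓘(P_ζ), ord_ζ D)]_ζ` over the codimension-one
points `ζ` of `Supp D` (`P_ζ = cl{ζ}`, exponents `≥ 1`): members irreducible, reduced, effective Cartier, REGULAR, inside
`Supp D`, locally EQUAL to `𝓘(Supp D)`, pairwise DISJOINT, without repetition, covering `Supp D`.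
[cite: CossartPiltant2008, proof of Prop. 4.2] [cite: Kollar2007, (3.111) Step 3] [cite: Matsumura1987, Thm. 20.3] -/
theorem exists_endFactor {W : Scheme.{u}} [IsIntegral W] [IsNoetherian W] (hW : Scheme.IsRegular W) {D : W.IdealSheafData}
    (hD : IsEffectiveCartier D) (hreg : Scheme.IsRegular (vanishingIdeal D.support).subscheme) :
    ∃ 𝓟 : List (W.IdealSheafData × ℕ),
      D = monomialIdeal 𝓟 ∧
      (∀ p ∈ 𝓟, 1 ≤ p.2) ∧
      (boundaryOf 𝓟).Nodup ∧
      (∀ p ∈ 𝓟, IsIrreducible (p.1.support : Set W) ∧ p.1 = vanishingIdeal p.1.support ∧ IsEffectiveCartier p.1 ∧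
        Scheme.IsRegular p.1.subscheme ∧ (p.1.support : Set W) ⊆ D.support ∧
        ∀ x ∈ p.1.support, stalkIdeal p.1 x = stalkIdeal (vanishingIdeal D.support) x) ∧
      (boundaryOf 𝓟).Pairwise (fun P Q => Disjoint (P.support : Set W) (Q.support : Set W)) ∧
      ((D.support : Set W) = ⋃ p ∈ 𝓟, (p.1.support : Set W)) := by
  classical
  set Dr : W.IdealSheafData := vanishingIdeal D.support with hDr
  have hDrsupp : (Dr.support : Set W) = D.support := Scheme.IdealSheafData.coe_support_vanishingIdeal D.support
  -- the pieces (connected = irreducible components) of the regular `V(√D)`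
  set Zs := Kollar2007.boundaryPieces Dr with hZs
  have hP : IsPiecePartition Dr Zs := isPiecePartition_boundaryPieces_of_isRegular hreg
  -- `D ≠ 0`, `Supp D ≠ W`
  have hDne : D ≠ ⊥ := fun h => DepthOne.not_isEffectiveCartier_bot (E := W) (h ▸ hD)
  have hSne : (D.support : Set W) ≠ Set.univ := fun h =>
    not_mem_support_genericPoint hDne (show genericPoint W ∈ (D.support : Set W) from h ▸ Set.mem_univ _)
  -- the divisorial part: `D = ∏_ζ 𝓘(P_ζ)^{ord_ζ D}` over the codimension-one points of `Supp D`
  have hfin : (divisorialPoints D).Finite := finite_divisorialPoints hDne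
  have hDeq : D = ∏ ζ ∈ hfin.toFinset, primeDivisorIdeal ζ ^ (idealOrder D ζ).toNat := by
    rw [← divisorialPart_eq hfin]
    exact (divisorialPart_eq_self_of_isLocallyPrincipal hW hDne hD.isLocallyPrincipal).symm
  have hmemT : ∀ {ζ}, ζ ∈ hfin.toFinset ↔ ζ ∈ D.support ∧ Order.coheight ζ = 1 := fun {ζ} => by
    rw [Set.Finite.mem_toFinset, mem_divisorialPoints_iff]
  -- each `cl{ζ}` is a piece
  have hpiece : ∀ {ζ}, ζ ∈ hfin.toFinset → (⟨closure {ζ}, isClosed_closure⟩ : Closeds W) ∈ Zs := by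
    intro ζ hζ
    obtain ⟨hζD, hζ1⟩ := hmemT.mp hζ
    rw [hZs, Kollar2007.mem_boundaryPieces_iff, hDrsupp]
    exact DepthOne.closure_singleton_mem_componentsIn hζ1 D.support.isClosed hSne hζD
  -- the per-component facts
  have hPsupp : ∀ ζ, ((primeDivisorIdeal ζ).support : Set W) = closure {ζ} := coe_support_primeDivisorIdeal
  have hPsub : ∀ {ζ}, ζ ∈ hfin.toFinset → ((primeDivisorIdeal ζ).support : Set W) ⊆ D.support := by
    intro ζ hζ
    rw [hPsupp]
    exact closure_minimal (Set.singleton_subset_iff.mpr (hmemT.mp hζ).1) D.support.isClosed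
  have hPstalk : ∀ {ζ}, ζ ∈ hfin.toFinset → ∀ x ∈ (primeDivisorIdeal ζ).support,
      stalkIdeal (primeDivisorIdeal ζ) x = stalkIdeal Dr x := by
    intro ζ hζ x hx
    have hx' : x ∈ ((⟨closure {ζ}, isClosed_closure⟩ : Closeds W) : Set W) := by
      rw [← SetLike.mem_coe, hPsupp] at hx; exact hx
    exact stalkIdeal_centrePiece_eq hreg hP (hpiece hζ) hx'
  have hPreg : ∀ {ζ}, ζ ∈ hfin.toFinset → Scheme.IsRegular (primeDivisorIdeal ζ).subscheme := fun {ζ} hζ =>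
    isRegular_subscheme_vanishingIdeal_piece hreg hP (hpiece hζ)
  have hPcart : ∀ {ζ}, ζ ∈ hfin.toFinset → IsEffectiveCartier (primeDivisorIdeal ζ) := fun {ζ} hζ =>
    isEffectiveCartier_primeDivisorIdeal_of_isRegular hW (hmemT.mp hζ).2
  have hPrad : ∀ ζ : W, primeDivisorIdeal ζ = vanishingIdeal (primeDivisorIdeal ζ).support := by
    intro ζ
    have h : (primeDivisorIdeal ζ).support = (⟨closure {ζ}, isClosed_closure⟩ : Closeds W) := Closeds.ext (hPsupp ζ)
    rw [h]; rfl
  have hPexp : ∀ {ζ}, ζ ∈ hfin.toFinset → 1 ≤ (idealOrder D ζ).toNat := by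
    intro ζ hζ
    obtain ⟨hζD, hζ1⟩ := hmemT.mp hζ
    obtain ⟨a, ha, -⟩ := exists_stalkIdeal_eq_maximalIdeal_pow hW hζ1 hDne
    have h1 : (1 : ℕ∞) ≤ idealOrder D ζ := (one_le_idealOrder_iff D ζ).mpr hζD
    rw [ha] at h1 ⊢
    simp only [ENat.toNat_coe]
    exact_mod_cast h1
  -- two codimension-one points of `Supp D` with a common specialisation coincide (the pieces are disjoint)
  have hinj : ∀ {ζ ζ'}, ζ ∈ hfin.toFinset → ζ' ∈ hfin.toFinset → ∀ {x : W}, ζ ⤳ x → ζ' ⤳ x → ζ = ζ' := by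
    intro ζ ζ' hζ hζ' x hx hx'
    have heq := hP.eq_of_mem (hpiece hζ) (hpiece hζ') (x := x) (specializes_iff_mem_closure.mp hx)
      (specializes_iff_mem_closure.mp hx')
    have hcl : closure ({ζ} : Set W) = closure {ζ'} := congrArg (fun Z : Closeds W => (Z : Set W)) heq
    have h1 : ζ' ⤳ ζ := specializes_iff_mem_closure.mpr (hcl ▸ subset_closure rfl)
    have h2 : ζ ⤳ ζ' := specializes_iff_mem_closure.mpr (hcl.symm ▸ subset_closure rfl)
    exact (h2.antisymm h1).eq
  -- THE LIST
  set 𝓟 : List (W.IdealSheafData × ℕ) :=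
    hfin.toFinset.toList.map fun ζ => (primeDivisorIdeal ζ, (idealOrder D ζ).toNat) with h𝓟
  have hmem𝓟 : ∀ {p}, p ∈ 𝓟 ↔ ∃ ζ ∈ hfin.toFinset, (primeDivisorIdeal ζ, (idealOrder D ζ).toNat) = p := by
    intro p
    simp only [h𝓟, List.mem_map, Finset.mem_toList]
  have hfst𝓟 : boundaryOf 𝓟 = hfin.toFinset.toList.map primeDivisorIdeal := by
    rw [boundaryOf, h𝓟, List.map_map]; rfl
  -- (1) the factorisation
  have hfac : D = monomialIdeal 𝓟 := by
    rw [hDeq, monomialIdeal, h𝓟, List.map_map, ← Finset.prod_map_toList]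
    rfl
  refine ⟨𝓟, hfac, ?_, ?_, ?_, ?_, ?_⟩
  · -- (2) exponents `≥ 1`
    intro p hp
    obtain ⟨ζ, hζ, rfl⟩ := hmem𝓟.mp hp
    exact hPexp hζ
  · -- (3) no repeated component
    rw [hfst𝓟]
    refine (Finset.nodup_toList _).map_on fun ζ hζ ζ' hζ' h => ?_
    rw [Finset.mem_toList] at hζ hζ'
    have hcl : closure ({ζ} : Set W) = closure {ζ'} := by rw [← hPsupp, ← hPsupp, h]
    have h1 : ζ' ⤳ ζ := specializes_iff_mem_closure.mpr (hcl ▸ subset_closure rfl)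
    have h2 : ζ ⤳ ζ' := specializes_iff_mem_closure.mpr (hcl.symm ▸ subset_closure rfl)
    exact (h2.antisymm h1).eq
  · -- (4) per-component facts
    intro p hp
    obtain ⟨ζ, hζ, rfl⟩ := hmem𝓟.mp hp
    exact ⟨(hPsupp ζ).symm ▸ isIrreducible_singleton.closure, hPrad ζ, hPcart hζ, hPreg hζ, hPsub hζ, hPstalk hζ⟩
  · -- (5) pairwise disjoint
    rw [hfst𝓟, List.pairwise_map]
    refine (Finset.nodup_toList _).pairwise_of_forall_ne fun ζ hζ ζ' hζ' hne => ?_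
    rw [Finset.mem_toList] at hζ hζ'
    refine Set.disjoint_left.mpr fun x hx hx' => hne ?_
    rw [hPsupp] at hx hx'
    exact hinj hζ hζ' (specializes_iff_mem_closure.mpr hx) (specializes_iff_mem_closure.mpr hx')
  · -- (6) the components cover the host
    apply le_antisymm
    · intro x hx
      have hx' : x ∈ (monomialIdeal 𝓟).support := by rw [← hfac]; exact hx
      obtain ⟨p, hp, -, hxp⟩ := (DepthGraded.MixedStep.mem_support_monomialIdeal_iff 𝓟 x).mp hx'
      exact Set.mem_biUnion hp hxp
    · intro x hx
      simp only [Set.mem_iUnion, exists_prop] at hx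
      obtain ⟨p, hp, hxp⟩ := hx
      obtain ⟨ζ, hζ, rfl⟩ := hmem𝓟.mp hp
      exact hPsub hζ hxp

/-! ## §3 THE END PACKAGE (transport state without `hostRad` + the CJS end clauses) -/

section End

variable {E₁ Z₁ : Scheme.{u}} [IsIntegral E₁] [IsNoetherian E₁] [IsLocallyNoetherian Z₁]
  {𝔟' D' : E₁.IdealSheafData} {ℬ' 𝒟' : List (E₁.IdealSheafData × ℕ)}

/-- [OURS · L1 W5.2 · F5c] **THE END PACKAGE WITHOUT REDUCEDNESS (explicit hypotheses).**  Transport state on `E₁`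
(regular; host `D′` effective Cartier; boundary snc, irreducible supports, none on the host; (J#) at host points on
N-charged members) + the CJS end clauses through `e : E₁ ≅ Z₁` exactly as in `StateIn.endClauses` ⟹ the host FACTORISES
(N5) with exponents `≥ 1`, no repeated component, ONE snc family `HasSNC (boundaryOf 𝓟 ++ boundaryOf ℬ′)`, components
irreducible / reduced / Cartier / REGULAR / inside `Supp D′` / NOT boundary sheaves / locally `= 𝓘(Supp D′)`, pairwise
disjoint, covering `Supp D′`, `V(𝓘(Supp D′))` regular, components of exponent `≥ 2` DISJOINT from every N-charged member,
no boundary sheaf containing the host. [cite: CossartPiltant2008, proof of Prop. 4.2]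
[cite: CossartJannsenSaito2020, Thm. 1.4, p. 7] [cite: Kollar2007, (3.111) Step 3, 3.104 Step 2.1] [cite: Matsumura1987, Thm. 14.2] -/
theorem endPackage (hE₁ : Scheme.IsRegular E₁) (hD : IsEffectiveCartier D') (hsncB : HasSNC (boundaryOf ℬ'))
    (hirred : ∀ p ∈ ℬ', IsIrreducible (p.1.support : Set E₁))
    (hfree : ∀ p ∈ ℬ', ¬ ((p.1.support : Set E₁) ⊆ D'.support))
    (hjoint : ∀ x ∈ D'.support, (∃ p ∈ 𝒟', 0 < p.2 ∧ x ∈ p.1.support) → SNCWithAt (D' :: charged ℬ' 𝒟') ⊤ x)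
    (e : E₁ ≅ Z₁) {X₁ B₁ : Set Z₁} (hX₁c : IsClosed X₁)
    (hX₁ : Scheme.IsRegular (vanishingIdeal ⟨closure X₁, isClosed_closure⟩).subscheme) (htr : IsTransversalWith Z₁ X₁ B₁)
    (hsupp : (D'.support : Set E₁) = e.hom ⁻¹' closure X₁) (hbd : ∀ p ∈ ℬ', (p.1.support : Set E₁) ⊆ e.hom ⁻¹' B₁) :
    ∃ 𝓟 : List (E₁.IdealSheafData × ℕ),
      D' = monomialIdeal 𝓟 ∧
      (∀ p ∈ 𝓟, 1 ≤ p.2) ∧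
      (boundaryOf 𝓟).Nodup ∧
      HasSNC (boundaryOf 𝓟 ++ boundaryOf ℬ') ∧
      (∀ p ∈ 𝓟, IsIrreducible (p.1.support : Set E₁) ∧ p.1 = vanishingIdeal p.1.support ∧ IsEffectiveCartier p.1 ∧
        Scheme.IsRegular p.1.subscheme ∧ (p.1.support : Set E₁) ⊆ D'.support ∧ p.1 ∉ boundaryOf ℬ' ∧
        ∀ x ∈ p.1.support, stalkIdeal p.1 x = stalkIdeal (vanishingIdeal D'.support) x) ∧
      (boundaryOf 𝓟).Pairwise (fun P Q => Disjoint (P.support : Set E₁) (Q.support : Set E₁)) ∧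
      ((D'.support : Set E₁) = ⋃ p ∈ 𝓟, (p.1.support : Set E₁)) ∧
      Scheme.IsRegular (vanishingIdeal D'.support).subscheme ∧
      (∀ p ∈ 𝓟, 2 ≤ p.2 → ∀ q ∈ 𝒟', 0 < q.2 → Disjoint (q.1.support : Set E₁) (p.1.support : Set E₁)) ∧
      (∀ q ∈ ℬ', ¬ D' ≤ q.1) := by
  classical
  -- the reduced host `√D′ = 𝓘(Supp D′)` is the pulled-back ideal of `cl X₁`: regular, snc WITH the boundary
  set T : Closeds Z₁ := ⟨closure X₁, isClosed_closure⟩ with hT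
  set Dr : E₁.IdealSheafData := vanishingIdeal D'.support with hDr
  have hDcomap : (vanishingIdeal T).comap e.hom = Dr := by
    rw [comap_hom_vanishingIdeal]; congr 1; exact (Closeds.ext hsupp).symm
  have hregDr : Scheme.IsRegular Dr.subscheme := by
    rw [← hDcomap]; exact isRegular_subscheme_comap_of_isOpenImmersion e.hom _ hX₁
  have hTsupp : ((vanishingIdeal T).support : Set Z₁) = closure X₁ := Scheme.IdealSheafData.coe_support_vanishingIdeal T
  have hnc : IsNormalCrossingWith Z₁ ((vanishingIdeal T).support : Set Z₁) B₁ := by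
    rw [hTsupp, hX₁c.closure_eq]; exact htr.isNormalCrossingWith
  have hℬDr : HasSNCWith (boundaryOf ℬ') Dr := by
    rw [← hDcomap]
    refine hasSNCWith_comap_of_isNormalCrossingWith e hsncB (fun K hK => ?_) ?_ hnc
    · obtain ⟨p, hp, rfl⟩ := List.mem_map.mp hK
      exact hbd p hp
    · have hs : (vanishingIdeal T).support = T := Closeds.ext (Scheme.IdealSheafData.coe_support_vanishingIdeal T)
      rw [hs]
  -- N5: the factorisation of the host
  obtain ⟨𝓟, hfac, hexp, hnodup, hcomp, hdisj, hcover⟩ := exists_endFactor hE₁ hD hregDr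
  -- the components are not boundary sheaves
  have hPfree : ∀ p ∈ 𝓟, p.1 ∉ boundaryOf ℬ' := by
    intro p hp h
    obtain ⟨q, hq, hq1⟩ := List.mem_map.mp h
    exact hfree q hq (hq1 ▸ (hcomp p hp).2.2.2.2.1)
  -- two components with a common point coincide
  have huniq : ∀ {p p' : E₁.IdealSheafData × ℕ}, p ∈ 𝓟 → p' ∈ 𝓟 → ∀ {x : E₁}, x ∈ p.1.support → x ∈ p'.1.support →
      p.1 = p'.1 := by
    intro p p' hp hp' x hx hx'
    by_contra hne
    haveI : Std.Symm (fun P Q : E₁.IdealSheafData => Disjoint (P.support : Set E₁) (Q.support : Set E₁)) :=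
      ⟨fun _ _ h => h.symm⟩
    have hd := hdisj.forall (fst_mem_boundaryOf hp) (fst_mem_boundaryOf hp') hne
    exact Set.disjoint_left.mp hd hx hx'
  refine ⟨𝓟, hfac, hexp, hnodup, ?_, fun p hp => ?_, hdisj, hcover, hregDr, ?_,
    fun q hq h => hfree q hq (support_antitone h)⟩
  · -- ONE snc family: components ++ boundary
    refine hasSNCWith_of_forall_sncWithAt fun x => ?_
    by_cases hx : ∃ p ∈ 𝓟, x ∈ p.1.support
    · obtain ⟨p, hp, hxp⟩ := hx
      obtain ⟨-, -, hPcart, hPreg, hPsub, hPstalk⟩ := hcomp p hp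
      haveI := hE₁ x
      -- the component through `x` is snc with the boundary at `x`, of order one, transversal to the boundary members
      have hℬ : SNCWithAt (boundaryOf ℬ') p.1 x := (hℬDr.sncWithAt x).centre_congr (hPstalk x hxp)
      have hhost : SNCWithAt [p.1] ⊤ x := sncWithAt_singleton_of_isRegular_subscheme hE₁ hPcart hPreg x
      have hcons : SNCWithAt (p.1 :: boundaryOf ℬ') ⊤ x := by
        refine (SNCWithAt.host_cons_transversal hℬ hhost le_rfl fun B hB hxB => ⟨hB, ?_⟩).top
        obtain ⟨q, hq, rfl⟩ := List.mem_map.mp hB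
        exact not_stalkIdeal_boundary_le hE₁ hsncB hirred hfree hPcart hPsub hq hxB hxp
      -- every member of the big family through `x` is the component through `x` or a boundary sheaf
      refine hcons.anti fun K hK hxK => ?_
      rcases List.mem_append.mp hK with hK | hK
      · obtain ⟨p', hp', rfl⟩ := List.mem_map.mp hK
        rw [← huniq hp hp' hxp hxK]
        exact List.mem_cons_self
      · exact List.mem_cons_of_mem _ hK
    · push Not at hx
      refine (hsncB.sncWithAt x).anti fun K hK hxK => ?_
      rcases List.mem_append.mp hK with hK | hK
      · obtain ⟨p', hp', rfl⟩ := List.mem_map.mp hK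
        exact absurd hxK (hx p' hp')
      · exact hK
  · -- per-component facts
    obtain ⟨h1, h2, h3, h4, h5, h6⟩ := hcomp p hp
    exact ⟨h1, h2, h3, h4, h5, hPfree p hp, h6⟩
  · -- components of exponent `≥ 2` miss the N-charged members: (J#) makes the host a parameter there
    intro p hp h2 q hq hq0
    refine Set.disjoint_left.mpr fun x hxq hxP => ?_
    haveI := hE₁ x
    have hxD : x ∈ D'.support := (hcomp p hp).2.2.2.2.1 hxP
    have hj := hjoint x hxD ⟨q, hq, hq0, hxq⟩
    refine not_stalkIdeal_le_sq_of_sncWithAt hj List.mem_cons_self hxD ?_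
    have hle : D' ≤ p.1 ^ p.2 :=
      hfac.le.trans (IdealSheafData.prod_le_of_mem (L := 𝓟.map fun p => p.1 ^ p.2) (List.mem_map.mpr ⟨p, hp, rfl⟩))
    refine (stalkIdeal_mono hle x).trans ?_
    rw [stalkIdeal_pow]
    exact (Ideal.pow_right_mono ((mem_support_iff_stalkIdeal_le _ x).mp hxP) _).trans (Ideal.pow_le_pow_right h2)

end End

end Nr

/-- [OURS · L1 W5.2 · F5c] **THE END PACKAGE from `StateNr`** (`StateIn` minus `hostRad`, `…DepthWeightTwoBNrState`):
`Nr.endPackage` on the fields ⟨`regW`, `hostCartier`, `sncB`, `irred`, `free`, `joint`⟩. [cite: CossartJannsenSaito2020, Thm. 1.4, p. 7] -/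
theorem StateNr.endPackage {E₁ Z₁ : Scheme.{u}} [IsIntegral E₁] [IsNoetherian E₁] [IsLocallyNoetherian Z₁]
    {𝔟' D' : E₁.IdealSheafData} {ℬ' 𝒟' : List (E₁.IdealSheafData × ℕ)} (S : StateNr 𝔟' D' ℬ' 𝒟')
    (e : E₁ ≅ Z₁) {X₁ B₁ : Set Z₁} (hX₁c : IsClosed X₁)
    (hX₁ : Scheme.IsRegular (vanishingIdeal ⟨closure X₁, isClosed_closure⟩).subscheme) (htr : IsTransversalWith Z₁ X₁ B₁)
    (hsupp : (D'.support : Set E₁) = e.hom ⁻¹' closure X₁) (hbd : ∀ p ∈ ℬ', (p.1.support : Set E₁) ⊆ e.hom ⁻¹' B₁) :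
    ∃ 𝓟 : List (E₁.IdealSheafData × ℕ),
      D' = monomialIdeal 𝓟 ∧
      (∀ p ∈ 𝓟, 1 ≤ p.2) ∧
      (boundaryOf 𝓟).Nodup ∧
      HasSNC (boundaryOf 𝓟 ++ boundaryOf ℬ') ∧
      (∀ p ∈ 𝓟, IsIrreducible (p.1.support : Set E₁) ∧ p.1 = vanishingIdeal p.1.support ∧ IsEffectiveCartier p.1 ∧
        Scheme.IsRegular p.1.subscheme ∧ (p.1.support : Set E₁) ⊆ D'.support ∧ p.1 ∉ boundaryOf ℬ' ∧
        ∀ x ∈ p.1.support, stalkIdeal p.1 x = stalkIdeal (vanishingIdeal D'.support) x) ∧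
      (boundaryOf 𝓟).Pairwise (fun P Q => Disjoint (P.support : Set E₁) (Q.support : Set E₁)) ∧
      ((D'.support : Set E₁) = ⋃ p ∈ 𝓟, (p.1.support : Set E₁)) ∧
      Scheme.IsRegular (vanishingIdeal D'.support).subscheme ∧
      (∀ p ∈ 𝓟, 2 ≤ p.2 → ∀ q ∈ 𝒟', 0 < q.2 → Disjoint (q.1.support : Set E₁) (p.1.support : Set E₁)) ∧
      (∀ q ∈ ℬ', ¬ D' ≤ q.1) :=
  Nr.endPackage S.regW S.hostCartier S.sncB S.irred S.free S.joint e hX₁c hX₁ htr hsupp hbd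

end WeightTwoB

end Summit.ResolutionOfSingularities.ResolutionOfSingularities.Theorems

end
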